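import Summits.CriticalPhenomena.CardyFormulaZ2.Theorems.CardyWhiteToColouredSimilarityUpgradeStubRectangleFamily
import Literature.Probability.RandomPlanarGeometry.RectangleModulusAspectRatio

/-!
# Stub `stub_modulusGlue` (line `registered`, crux `SimilarityUpgrade`, stmt-CriticalPhenomena-4597)

Crux `Summit.CriticalPhenomena.CardyFormulaZ2.Theses.CardyWhiteToColoured.SimilarityUpgrade`,
route `CardyWhiteToColoured`, sub-problem `CardyFormulaZ2`, line `registered`, stub **G**
`stub_modulusGlue`: rectangle continuity (H1) + the rectilinear heart (H3) ⇒ the c1 heart H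
(factorisation of a full, similarity-invariant bond-ℤ² crossing limit `Φ` through the conformal
modulus on rectilinear conformal rectangles, through some `f` continuous on `(0,1)`).

Proof. Let `η : (0,∞) → (0,1)` be the modulus function of
`rectangle_crossRatio_eq_of_aspectRatio_holds` (strictly antitone, onto) and `Qc w` the
corner-marked box `(0,w) × (0,1)` with marks `i, 0, w, w + i` and arcs `0/2` the left/right sides
(c1's `RectangleFamily.exists_shift3` applied to `rectQuad 0 w 0 1`; carrier, arcs and marks are
`RectangleFamily.lr_family` / `RectangleFamily.lr_pt`). Every uniformizing datum of `Qc w` has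
cross-ratio `η w`. Put `f t := Φ (Qc (η⁻¹ t))` with `η⁻¹` a chosen right inverse on `(0,1)`.
The heart H3 gives `Φ R = Φ (Qc (η⁻¹ (crossRatio x))) = f (crossRatio x)` for rectilinear `R`
(the two rectangles have the same modulus). Continuity of `f` on `(0,1)`: `w ↦ Φ (Qc w)` is
continuous on `(0,∞)` by H1, and `η⁻¹` maps the interval `(η (w₀+ρ), η (w₀-ρ))` into
`(w₀-ρ, w₀+ρ)` by strict antitonicity of `η` (no continuity of `η` is needed). No definitions are
introduced.

References: B. Bollobás, O. Riordan, *Percolation* (2006), Ch. 7 §7.1 p. 184 (the modulus of a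
rectangle is a strictly decreasing function of the aspect ratio).
-/

noncomputable section

namespace Summit.CriticalPhenomena.CardyFormulaZ2.Cruxes.SimilarityUpgrade.Stubs

open Filter Topology Set
open Literature.Probability.RandomPlanarGeometry
open Literature.Probability.Percolation (bondDomainCrossingProb rectQuad)

/-- **stub_modulusGlue (G).** Rectangle continuity + the heart ⇒ the c1 heart H: with `η` the
modulus function of `rectangle_crossRatio_eq_of_aspectRatio_holds` (strictly antitone from `(0,∞)`
onto `(0,1)`) and a corner-marked box family `Qc` (c1's `RectangleFamily.exists_shift3` of
`rectQuad 0 w 0 1`: carrier, arcs, marks `i, 0, w, w+i`), put `f t := Φ (Qc (η⁻¹ t))`; the heart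
gives `Φ R = f (crossRatio x)` for rectilinear `R`, and `f` is continuous on `(0,1)` because
`w ↦ Φ (Qc w)` is (H1) and `η` is strictly antitone (no continuity of `η` needed: `η⁻¹` maps the
interval `(η (w₀+ρ), η (w₀-ρ))` into `(w₀-ρ, w₀+ρ)`). [cite: BollobasRiordan2006, Ch. 7 §7.1 p. 184] -/
theorem stub_modulusGlue :
    (∀ Φ : ConformalRectangle → ℝ,
      (∀ R : ConformalRectangle, Tendsto (bondDomainCrossingProb R) (𝓝[>] (0 : ℝ)) (𝓝 (Φ R))) →
      ∀ Q : ℝ → ConformalRectangle,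
        (∀ w : ℝ, 0 < w → (Q w).carrier = (Ioo (0 : ℝ) w ×ℂ Ioo (0 : ℝ) 1) ∧
          (Q w).arc 0 = {z : ℂ | z.re = 0 ∧ z.im ∈ Icc (0 : ℝ) 1} ∧
          (Q w).arc 2 = {z : ℂ | z.re = w ∧ z.im ∈ Icc (0 : ℝ) 1}) →
        ContinuousOn (fun w => Φ (Q w)) (Ioi 0)) →
    (∀ Φ : ConformalRectangle → ℝ,
      (∀ R : ConformalRectangle, Tendsto (bondDomainCrossingProb R) (𝓝[>] (0 : ℝ)) (𝓝 (Φ R))) →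
      (∀ (R R' : ConformalRectangle) (a w : ℂ), a ≠ 0 →
        R'.carrier = (fun z : ℂ => a * z + w) '' R.carrier →
        R'.arc 0 = (fun z : ℂ => a * z + w) '' R.arc 0 →
        R'.arc 2 = (fun z : ℂ => a * z + w) '' R.arc 2 → Φ R' = Φ R) →
      ∀ (R R' : ConformalRectangle),
        (∃ S : Finset (ℂ × ℂ), (∀ p ∈ S, p.1.re = p.2.re ∨ p.1.im = p.2.im) ∧
          frontier R.carrier ⊆ ⋃ p ∈ S, segment ℝ p.1 p.2) →
        (∃ w : ℝ, 0 < w ∧ R'.carrier = (Ioo (0 : ℝ) w ×ℂ Ioo (0 : ℝ) 1) ∧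
          R'.arc 0 = {z : ℂ | z.re = 0 ∧ z.im ∈ Icc (0 : ℝ) 1} ∧
          R'.arc 2 = {z : ℂ | z.re = w ∧ z.im ∈ Icc (0 : ℝ) 1} ∧
          R'.pt 0 = Complex.I ∧ R'.pt 1 = 0 ∧ R'.pt 2 = (w : ℂ) ∧ R'.pt 3 = (w : ℂ) + Complex.I) →
        ∀ (φ : ConformalEquiv UpperHalfPlane.upperHalfPlaneSet R.carrier) (x : Fin 4 → ℝ)
          (φ' : ConformalEquiv UpperHalfPlane.upperHalfPlaneSet R'.carrier) (x' : Fin 4 → ℝ),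
          R.IsUniformizing φ x → R'.IsUniformizing φ' x' → crossRatio x = crossRatio x' →
          Φ R = Φ R') →
    ∀ Φ : ConformalRectangle → ℝ,
      (∀ R : ConformalRectangle, Tendsto (bondDomainCrossingProb R) (𝓝[>] (0 : ℝ)) (𝓝 (Φ R))) →
      (∀ (R R' : ConformalRectangle) (a w : ℂ), a ≠ 0 →
        R'.carrier = (fun z : ℂ => a * z + w) '' R.carrier →
        R'.arc 0 = (fun z : ℂ => a * z + w) '' R.arc 0 →
        R'.arc 2 = (fun z : ℂ => a * z + w) '' R.arc 2 → Φ R' = Φ R) →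
      ∃ f : ℝ → ℝ, ContinuousOn f (Ioo 0 1) ∧
        ∀ R : ConformalRectangle,
          (∃ S : Finset (ℂ × ℂ), (∀ p ∈ S, p.1.re = p.2.re ∨ p.1.im = p.2.im) ∧
            frontier R.carrier ⊆ ⋃ p ∈ S, segment ℝ p.1 p.2) →
          ∀ (φ : ConformalEquiv UpperHalfPlane.upperHalfPlaneSet R.carrier) (x : Fin 4 → ℝ),
            R.IsUniformizing φ x → Φ R = f (crossRatio x) := by
  intro hH1 hH3 Φ hlim hsim
  -- the corner-marked box family `w ↦ sh (Q' w)` (c1, `stub_rectangleFamily`)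
  choose sh hsh using RectangleFamily.exists_shift3
  obtain ⟨Q', hQ'⟩ : ∃ Q' : ℝ → ConformalRectangle,
      ∀ (w : ℝ) (hw : 0 < w), Q' w = rectQuad 0 w 0 1 hw one_pos :=
    ⟨fun w => if h : 0 < w then rectQuad 0 w 0 1 h one_pos else rectQuad 0 1 0 1 one_pos one_pos,
      fun w hw => dif_pos hw⟩
  have hfam := RectangleFamily.lr_family sh hsh Q' hQ'
  have hpt := RectangleFamily.lr_pt sh hsh Q' hQ'
  -- the modulus function of rectangles
  obtain ⟨η, hanti, himage, hmod⟩ := rectangle_crossRatio_eq_of_aspectRatio_holds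
  have hQmod : ∀ w : ℝ, 0 < w →
      ∀ (ψ : ConformalEquiv UpperHalfPlane.upperHalfPlaneSet (sh (Q' w)).carrier) (y : Fin 4 → ℝ),
        (sh (Q' w)).IsUniformizing ψ y → crossRatio y = η w := by
    intro w hw ψ y hψ
    obtain ⟨p0, p1, p2, p3⟩ := hpt w hw
    obtain ⟨hcar, -, -⟩ := hfam w hw
    have key := hmod (sh (Q' w)) w 1 hw one_pos hcar
      ⟨by rw [p0]; simp, p1, p2, by rw [p3]; simp⟩ ψ y hψ
    rwa [div_one] at key
  -- a right inverse of `η` on `(0,1)`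
  have hex : ∀ t : ℝ, t ∈ Ioo (0 : ℝ) 1 → ∃ w : ℝ, w ∈ Ioi (0 : ℝ) ∧ η w = t := by
    intro t ht
    rw [← himage] at ht
    exact ht
  choose! winv hwinv_pos hη_winv using hex
  refine ⟨fun t => Φ (sh (Q' (winv t))), ?_, ?_⟩
  · -- continuity of `f` on `(0,1)`
    have hg : ContinuousOn (fun w => Φ (sh (Q' w))) (Ioi 0) := hH1 Φ hlim (fun w => sh (Q' w)) hfam
    intro t₀ ht₀
    have hw₀ : 0 < winv t₀ := hwinv_pos t₀ ht₀
    have hgat : ContinuousAt (fun w => Φ (sh (Q' w))) (winv t₀) :=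
      hg.continuousAt (Ioi_mem_nhds hw₀)
    rw [Metric.continuousWithinAt_iff]
    intro e he
    obtain ⟨ρ, hρ, hρ'⟩ := Metric.continuousAt_iff.1 hgat e he
    set w₀ : ℝ := winv t₀ with hw₀def
    have hηw₀ : η w₀ = t₀ := hη_winv t₀ ht₀
    set ρ₁ : ℝ := min (ρ / 2) (w₀ / 2) with hρ₁
    have hρ₁pos : 0 < ρ₁ := lt_min (by linarith) (by linarith)
    have hρ₁le : ρ₁ ≤ ρ / 2 := min_le_left _ _
    have hρ₁le' : ρ₁ ≤ w₀ / 2 := min_le_right _ _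
    have hu₁ : 0 < w₀ - ρ₁ := by linarith
    have hu₂ : 0 < w₀ + ρ₁ := by linarith
    have hlt₁ : η (w₀ + ρ₁) < t₀ := by
      rw [← hηw₀]
      exact hanti (mem_Ioi.2 hw₀) (mem_Ioi.2 hu₂) (by linarith)
    have hlt₂ : t₀ < η (w₀ - ρ₁) := by
      rw [← hηw₀]
      exact hanti (mem_Ioi.2 hu₁) (mem_Ioi.2 hw₀) (by linarith)
    refine ⟨min (t₀ - η (w₀ + ρ₁)) (η (w₀ - ρ₁) - t₀), lt_min (by linarith) (by linarith),
      fun t ht hdist => ?_⟩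
    have hw : 0 < winv t := hwinv_pos t ht
    have hηw : η (winv t) = t := hη_winv t ht
    rw [Real.dist_eq, abs_lt] at hdist
    have hm₁ := min_le_left (t₀ - η (w₀ + ρ₁)) (η (w₀ - ρ₁) - t₀)
    have hm₂ := min_le_right (t₀ - η (w₀ + ρ₁)) (η (w₀ - ρ₁) - t₀)
    have h₁ : η (w₀ + ρ₁) < η (winv t) := by
      rw [hηw]
      linarith [hdist.1]
    have h₂ : η (winv t) < η (w₀ - ρ₁) := by
      rw [hηw]
      linarith [hdist.2]
    have h₃ : winv t < w₀ + ρ₁ := (hanti.lt_iff_gt (mem_Ioi.2 hu₂) (mem_Ioi.2 hw)).1 h₁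
    have h₄ : w₀ - ρ₁ < winv t := (hanti.lt_iff_gt (mem_Ioi.2 hw) (mem_Ioi.2 hu₁)).1 h₂
    apply hρ'
    rw [Real.dist_eq, abs_lt]
    constructor <;> linarith
  · -- factorisation through the modulus, by the heart H3
    intro R hR φ x hφ
    have ht : crossRatio x ∈ Ioo (0 : ℝ) 1 :=
      ConformalRectangle.crossRatio_mem_Ioo_of_isUniformizing hφ
    have hw : 0 < winv (crossRatio x) := hwinv_pos _ ht
    obtain ⟨ψ, y, hψ⟩ := MarkedDomain.exists_isUniformizing_holds (sh (Q' (winv (crossRatio x))))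
    obtain ⟨hcar, ha0, ha2⟩ := hfam _ hw
    obtain ⟨p0, p1, p2, p3⟩ := hpt _ hw
    exact hH3 Φ hlim hsim R (sh (Q' (winv (crossRatio x)))) hR
      ⟨winv (crossRatio x), hw, hcar, ha0, ha2, p0, p1, p2, p3⟩ φ x ψ y hφ hψ
      (by rw [hQmod _ hw ψ y hψ, hη_winv _ ht])

end Summit.CriticalPhenomena.CardyFormulaZ2.Cruxes.SimilarityUpgrade.Stubs

end
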